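import Literature.AlgebraicGeometry.GroupSchemes.AffineGroupSchemeHopfAlgebra
import Literature.AlgebraicGeometry.GroupSchemes.SubgroupSchemeOfSubgroupIdeal
import Mathlib.RingTheory.HopfAlgebra.Quotient
import Mathlib.RingTheory.Bialgebra.Convolution
import HarnessLib

/-!
# A Hopf ideal `I ⊂ Γ(G, 𝒪_G)` of an affine group scheme cuts out a closed subgroup SCHEME `Spec(Γ(G)∕I) ↪ G`

Layer `Literature/AlgebraicGeometry/GroupSchemes`, namespace `Literature.AlgebraicGeometry.GroupSchemes.AffineGroupScheme` (continues ★
`AffineGroupSchemeHopfAlgebra`, p844646).  Two small `def`s (`isoSpecOver`, `quotIncl`) + theorems; no instance, no notation, no named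
fact, no `sorry`.  Cell `hodgecm-mathlib` (D-0151), programme P6 «MOD», HEART organ **(GAP-1) clause (iv) = F0P6b-plan (g0)'s (ii)
`HopfIdealClosedSubgroup`** («closed subgroup scheme ↔ Hopf ideal», RE-DEAL TABLE 13:29:45Z (C); handed to B-p04 (g36) by F0P6-p16 (g0)
13:35:11Z); the engine behind `stub_b1a_unitComponent` σ1 «HOPF» (`G₀ := Spec (B ⧸ (1 − e)) ↪ G`, F0P6-p09 (g0)).  Count-neutral
Mathlib-side capital: HC_CM is proved only modulo the 7 printed citations until rung 0 closes; nothing here bears on it.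

THE PRINT ([GortzWedhorn2023] (27.1.1) + §(27.2) p. 607: «closed subgroup schemes of `G = Spec A` ↔ Hopf ideals of `A`»; [Waterhouse,
*Affine group schemes*, §2.1]).  For a commutative ring `R`, an AFFINE group object `G` of `SchemeOver R = Over (Spec R)` (e.g. finite flat),
`A := Alg G = Γ(G, 𝒪_G)` with its ★ Hopf structure (`AffineGroupScheme.Alg.instHopfAlgebra`), and an ideal `I ⊂ A` that is a HOPF IDEAL
(Mathlib `Ideal.IsHopfIdeal R I`: a coideal stable under the antipode — e.g. ★ `Henselian/FiniteFlatHopfAlgebraUnitFactorHopf.isHopfIdeal_span_one_sub`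
for `I = (1 − e)`):

* §1 `isoSpecOver W : W ≅ specOver R (Alg W)` — every affine `R`-scheme is `Spec` of its algebra, OVER `R` (★ `isoSpec_hom_comp_SpecMap_algebraMapΓ`);
* §2 `quotIncl G I : specOver R (Alg G ⧸ I) ⟶ G` — the point of `G` whose algebra map is `A ↠ A∕I` (`ptEquiv.symm`); a CLOSED IMMERSION
  (`isClosedImmersion_quotIncl_left`) and a monomorphism;
* §3 POINTS: for `u : Spec R′ → G` over `R`, `u` factors through `quotIncl` iff its algebra map kills `I`
  (`exists_comp_quotIncl_eq_iff_le_ker`; ★ `ptEquiv_comap`);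
* §4 the points killing `I` form a SUBGROUP of `G(Spec R′)` — products by Mathlib's `convMul_comp_bialgHom_distrib` through the quotient
  bialgebra `A ⧸ I` (coideal), the unit by `counit(I) = 0`, inverses by `S(I) ⊆ I` (★ `groupLaw_mul_apply ∕ _one ∕ _inv_apply`,
  ★ `CorepGroupLaw.mul_eq ∕ one_eq ∕ inv_eq`);
* §5 hence the multiplication, unit and inversion of `G` LIFT through `quotIncl` (§1 transports the affine test objects
  `Spec(A∕I) ×_R Spec(A∕I)`, `Spec R`, `Spec(A∕I)` to `specOver`s) and ★ `exists_grpObj_isMonHom_of_lifts` (p844591) gives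
  **`exists_grpObj_isMonHom_quotIncl`**: `Spec (A ⧸ I)` is a group scheme over `R` for which `quotIncl` is a homomorphic closed immersion
  — the CLOSED SUBGROUP SCHEME `V(I) ≤ G`.

NOT HERE: the converse (the ideal of a closed subgroup scheme is a Hopf ideal), the clopen∕connectedness clauses of `G⁰` (σ1's own work).

## References
* [GortzWedhorn2023] U. Görtz, T. Wedhorn, *Algebraic Geometry II* (2023), (27.1.1), §(27.2) (27.2.1), Def. 27.6 (pp. 606–607).
* W. C. Waterhouse, *Introduction to Affine Group Schemes* (1979), §2.1 (closed subgroups and Hopf ideals).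
-/

set_option autoImplicit false

-- Mathlib's `Over`/`Scheme` APIs are stated across semireducible wrappers (as in the ★ `GroupSchemes/*` files).
set_option backward.isDefEq.respectTransparency false

universe u

open CategoryTheory CategoryTheory.Limits AlgebraicGeometry MonoidalCategory CartesianMonoidalCategory TensorProduct WithConv

noncomputable section

namespace Literature.AlgebraicGeometry.GroupSchemes

namespace AffineGroupScheme

open scoped MonObj

open Literature.AlgebraicGeometry.Motives Literature.NumberTheory.DiophantineGeometry

variable {R : Type u} [CommRing R]

/-! ## §1 An affine `R`-scheme is `Spec` of its algebra, over `R` -/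

/-- **`W ≅ Spec Γ(W, 𝒪_W)` over `R`** for an affine `R`-scheme `W` (Mathlib `Scheme.isoSpec`; the triangle over `Spec R` is ★
`isoSpec_hom_comp_SpecMap_algebraMapΓ`). [cite: GortzWedhorn2023, §(27.2) (p. 606)] -/
def isoSpecOver (W : SchemeOver R) [IsAffine W.left] : W ≅ specOver R (Alg W) :=
  Over.isoMk W.left.isoSpec (isoSpec_hom_comp_SpecMap_algebraMapΓ W.hom)

/-- The underlying isomorphism of `isoSpecOver W` is `W.isoSpec`. [cite: GortzWedhorn2023, §(27.2) (p. 606)] -/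
theorem isoSpecOver_hom_left (W : SchemeOver R) [IsAffine W.left] : (isoSpecOver W).hom.left = W.left.isoSpec.hom := rfl

/-! ## §2 The closed immersion `Spec (A ⧸ I) ↪ G` -/

section Incl

variable (G : SchemeOver R) [IsAffine G.left] (I : Ideal (Alg G)) [I.IsTwoSided]

/-- **The inclusion `Spec (Γ(G) ⧸ I) ↪ G` over `R`**: the `Spec (A ⧸ I)`-valued point of `G` whose algebra map is the quotient map
`A ↠ A ⧸ I` (★ `ptEquiv`). [cite: GortzWedhorn2023, (27.1.1) and §(27.2) (p. 607)] -/
def quotIncl : specOver R (Alg G ⧸ I) ⟶ G := (ptEquiv G (Alg G ⧸ I)).symm (Ideal.Quotient.mkₐ R I)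

/-- The algebra map of `quotIncl` is `A ↠ A ⧸ I`. [cite: GortzWedhorn2023, §(27.2) (p. 607)] -/
theorem ptEquiv_quotIncl : ptEquiv G (Alg G ⧸ I) (quotIncl G I) = Ideal.Quotient.mkₐ R I :=
  Equiv.apply_symm_apply _ _

/-- The underlying morphism of `quotIncl` is `Spec (A ↠ A ⧸ I)` followed by `Spec Γ(G) ≅ G`. [cite: GortzWedhorn2023, §(27.2) (p. 607)] -/
theorem quotIncl_left : (quotIncl G I).left = Spec.map (CommRingCat.ofHom (Ideal.Quotient.mk I)) ≫ G.left.isoSpec.inv := rfl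

/-- **`Spec (A ⧸ I) ↪ G` is a closed immersion.** [cite: GortzWedhorn2023, (27.1.1) and §(27.2) (p. 607)] -/
theorem isClosedImmersion_quotIncl_left : IsClosedImmersion (quotIncl G I).left := by
  rw [quotIncl_left]
  exact MorphismProperty.comp_mem _ _ _ (IsClosedImmersion.spec_of_quotient_mk I) inferInstance

/-- `quotIncl` is a monomorphism of `R`-schemes. [cite: GortzWedhorn2023, (27.1.1)] -/
theorem mono_quotIncl : Mono (quotIncl G I) :=
  haveI := isClosedImmersion_quotIncl_left G I
  Over.mono_of_mono_left _

/-! ## §3 Points of `Spec (A ⧸ I) ↪ G`: the algebra map kills `I` -/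

variable {R' : Type u} [CommRing R'] [Algebra R R']

/-- The algebra map of a point `x ≫ quotIncl` through `Spec (A ⧸ I)` is `(A ↠ A ⧸ I)` followed by the algebra map of `x`, hence kills `I`.
[cite: GortzWedhorn2023, (27.1.1) and §(27.2) (p. 607)] -/
theorem le_ker_ptEquiv_comp_quotIncl (x : specOver R R' ⟶ specOver R (Alg G ⧸ I)) :
    I ≤ RingHom.ker (ptEquiv G R' (x ≫ quotIncl G I)).toRingHom := by
  -- the ring map is `Spec⁻¹(x.left ≫ Spec mk ≫ e⁻¹ ≫ e) = Spec⁻¹(x.left) ∘ mk`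
  have h : CommRingCat.ofHom (ptEquiv G R' (x ≫ quotIncl G I)).toRingHom =
      CommRingCat.ofHom (Ideal.Quotient.mk I) ≫ Spec.preimage x.left := by
    have e : (x ≫ quotIncl G I).left ≫ G.left.isoSpec.hom = x.left ≫ Spec.map (CommRingCat.ofHom (Ideal.Quotient.mk I)) := by
      rw [Over.comp_left, quotIncl_left]
      simp only [Category.assoc, Iso.inv_hom_id, Category.comp_id]
    rw [ofHom_ptEquiv, e, Spec.preimage_comp, Spec.preimage_map]
  intro a ha
  have h' := congrArg (fun φ : CommRingCat.of (Alg G) ⟶ CommRingCat.of R' => φ.hom a) h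
  simp only [CommRingCat.hom_ofHom, CommRingCat.hom_comp, RingHom.coe_comp, Function.comp_apply] at h'
  rw [RingHom.mem_ker, h', Ideal.Quotient.eq_zero_iff_mem.mpr ha, map_zero]

/-- **A point whose algebra map kills `I` factors through `Spec (A ⧸ I) ↪ G`** (`x := Spec` of the induced map `A ⧸ I → R′`;
★ `ptEquiv_comap`). [cite: GortzWedhorn2023, (27.1.1) and §(27.2) (p. 607)] -/
theorem exists_comp_quotIncl_eq_of_le_ker (u : specOver R R' ⟶ G) (h : I ≤ RingHom.ker (ptEquiv G R' u).toRingHom) :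
    ∃ x : specOver R R' ⟶ specOver R (Alg G ⧸ I), x ≫ quotIncl G I = u := by
  refine ⟨AlgPoints.specOverMapOfAlgHom (Ideal.Quotient.liftₐ I (ptEquiv G R' u) fun a ha => h ha), ?_⟩
  apply (ptEquiv G R').injective
  rw [ptEquiv_comap, ptEquiv_quotIncl, Ideal.Quotient.liftₐ_comp]

/-- **Points criterion**: `u` factors through `Spec (A ⧸ I) ↪ G` iff its algebra map kills `I`.
[cite: GortzWedhorn2023, (27.1.1) and §(27.2) (p. 607)] -/
theorem exists_comp_quotIncl_eq_iff_le_ker (u : specOver R R' ⟶ G) :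
    (∃ x : specOver R R' ⟶ specOver R (Alg G ⧸ I), x ≫ quotIncl G I = u) ↔ I ≤ RingHom.ker (ptEquiv G R' u).toRingHom := by
  constructor
  · rintro ⟨x, rfl⟩
    exact le_ker_ptEquiv_comp_quotIncl G I x
  · exact exists_comp_quotIncl_eq_of_le_ker G I u

end Incl

/-! ## §4 The points killing a Hopf ideal form a subgroup -/

section Subgroup

variable (G : SchemeOver R) [GrpObj G] [IsAffine G.left] (I : Ideal (Alg G)) [I.IsHopfIdeal R]
  {R' : Type u} [CommRing R'] [Algebra R R']

/-- **Products**: if the algebra maps of `u` and `v` kill the Hopf ideal `I`, so does that of `u · v` — it is the convolution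
`ū ⋆ v̄` of the induced maps on the quotient BIALGEBRA `A ⧸ I`, precomposed with `A ↠ A ⧸ I` (Mathlib `convMul_comp_bialgHom_distrib`).
[cite: GortzWedhorn2023, §(27.2) (27.2.1) (pp. 606–607)] -/
theorem le_ker_ptEquiv_mul [I.IsTwoSided] {u v : specOver R R' ⟶ G} (hu : I ≤ RingHom.ker (ptEquiv G R' u).toRingHom)
    (hv : I ≤ RingHom.ker (ptEquiv G R' v).toRingHom) : I ≤ RingHom.ker (ptEquiv G R' (u * v)).toRingHom := by
  -- the induced maps on `A ⧸ I`
  set ub : (Alg G ⧸ I) →ₐ[R] R' := Ideal.Quotient.liftₐ I (ptEquiv G R' u) fun a ha => hu ha with hub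
  set vb : (Alg G ⧸ I) →ₐ[R] R' := Ideal.Quotient.liftₐ I (ptEquiv G R' v) fun a ha => hv ha with hvb
  have hu' : ptEquiv G R' u = ub.comp (Ideal.Quotient.mkₐ R I) := (Ideal.Quotient.liftₐ_comp I _ _).symm
  have hv' : ptEquiv G R' v = vb.comp (Ideal.Quotient.mkₐ R I) := (Ideal.Quotient.liftₐ_comp I _ _).symm
  -- `ptEquiv (u · v) = (ū ⋆ v̄) ∘ mk`
  have key : ptEquiv G R' (u * v) = (toConv ub * toConv vb).ofConv.comp (Ideal.Quotient.mkₐ R I) := by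
    have h1 : ptEquiv G R' (u * v) = ofConv (toConv (ptEquiv G R' u) * toConv (ptEquiv G R' v)) := by
      rw [← groupLaw_mul_apply, ← (groupLaw G).toConv_mul, ofConv_toConv]
    have h2 : (toConv ub * toConv vb).ofConv.comp (Bialgebra.Quotient.mkBialgHom (R := R) I : Alg G →ₐ[R] Alg G ⧸ I) =
        ofConv (toConv (ub.comp (Bialgebra.Quotient.mkBialgHom (R := R) I : Alg G →ₐ[R] Alg G ⧸ I)) *
          toConv (vb.comp (Bialgebra.Quotient.mkBialgHom (R := R) I : Alg G →ₐ[R] Alg G ⧸ I))) :=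
      AlgHom.convMul_comp_bialgHom_distrib _ _ _
    rw [h1, hu', hv']
    exact h2.symm
  intro a ha
  rw [RingHom.mem_ker, AlgHom.toRingHom_eq_coe, AlgHom.coe_toRingHom, key, AlgHom.comp_apply, Ideal.Quotient.mkₐ_eq_mk,
    Ideal.Quotient.eq_zero_iff_mem.mpr ha, map_zero]

/-- **Unit**: the algebra map of the unit point is `R ← K ∘ ε`, and the counit kills a coideal.
[cite: GortzWedhorn2023, §(27.2) (27.2.1) (pp. 606–607)] -/
theorem le_ker_ptEquiv_one : I ≤ RingHom.ker (ptEquiv G R' (1 : specOver R R' ⟶ G)).toRingHom := by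
  intro a ha
  rw [RingHom.mem_ker, AlgHom.toRingHom_eq_coe, AlgHom.coe_toRingHom, ← groupLaw_one, (groupLaw G).one_eq, AlgHom.comp_apply]
  have h0 : (groupLaw G).counit a = 0 :=
    Submodule.IsCoideal.counit_eq_zero (I := I.restrictScalars R) (show a ∈ I.restrictScalars R from ha)
  rw [h0, map_zero]

/-- **Inverses**: the algebra map of `u⁻¹` is that of `u` precomposed with the antipode, which preserves a Hopf ideal.
[cite: GortzWedhorn2023, §(27.2) (27.2.1) (pp. 606–607)] -/
theorem le_ker_ptEquiv_inv {u : specOver R R' ⟶ G} (hu : I ≤ RingHom.ker (ptEquiv G R' u).toRingHom) :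
    I ≤ RingHom.ker (ptEquiv G R' u⁻¹).toRingHom := by
  intro a ha
  rw [RingHom.mem_ker, AlgHom.toRingHom_eq_coe, AlgHom.coe_toRingHom, ← groupLaw_inv_apply, (groupLaw G).inv_eq, AlgHom.comp_apply]
  have hS : (groupLaw G).antipodeAlgHom a ∈ I := Ideal.IsHopfIdeal.antipode_mem (R := R) ha
  exact hu hS

end Subgroup

/-! ## §5 The group structure of `Spec (A ⧸ I)` and the homomorphic closed immersion -/

section Lifts

variable (G : SchemeOver R) [IsAffine G.left] (I : Ideal (Alg G)) [I.IsTwoSided]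

/-- **Factorisation through `Spec (A ⧸ I)` for an AFFINE test object**: for `W` affine over `R` and `u : W ⟶ G`, if the algebra map of
the point `Spec Γ(W) ≅ W ⟶ G` kills `I` then `u` factors through `quotIncl` (§3 transported along ★-style `isoSpecOver`).
[cite: GortzWedhorn2023, (27.1.1) and §(27.2) (p. 607)] -/
theorem exists_comp_quotIncl_eq_of_affine {W : SchemeOver R} [IsAffine W.left] (u : W ⟶ G)
    (h : I ≤ RingHom.ker (ptEquiv G (Alg W) ((isoSpecOver W).inv ≫ u)).toRingHom) : ∃ y : W ⟶ specOver R (Alg G ⧸ I), y ≫ quotIncl G I = u := by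
  obtain ⟨x, hx⟩ := exists_comp_quotIncl_eq_of_le_ker G I _ h
  exact ⟨(isoSpecOver W).hom ≫ x, by rw [Category.assoc, hx, Iso.hom_inv_id_assoc]⟩

/-- A point through `Spec (A ⧸ I)` from an affine test object kills `I` (after transport to `Spec Γ(W)`).
[cite: GortzWedhorn2023, (27.1.1) and §(27.2) (p. 607)] -/
theorem le_ker_ptEquiv_isoSpecOver_inv_comp {W : SchemeOver R} [IsAffine W.left] (x : W ⟶ specOver R (Alg G ⧸ I)) :
    I ≤ RingHom.ker (ptEquiv G (Alg W) ((isoSpecOver W).inv ≫ x ≫ quotIncl G I)).toRingHom := by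
  rw [← Category.assoc]
  exact le_ker_ptEquiv_comp_quotIncl G I _

/-- **THE CLOSED SUBGROUP SCHEME OF A HOPF IDEAL.**  For an affine group object `G` of `SchemeOver R` and a Hopf ideal `I ⊂ Γ(G, 𝒪_G)`,
the `R`-scheme `Spec (Γ(G) ⧸ I)` carries a group-scheme structure for which the closed immersion `quotIncl : Spec (Γ(G) ⧸ I) ↪ G` is a
HOMOMORPHISM — the multiplication, unit and inversion of `G` lift through it (§4 on the affine test objects `Spec(A⧸I) ×_R Spec(A⧸I)`,
`Spec R`, `Spec(A⧸I)`) and ★ `exists_grpObj_isMonHom_of_lifts` applies.  With ★ `isHopfIdeal_span_one_sub` this is the unit component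
`G⁰ = V(1 − e)` of a finite flat group scheme over a henselian local ring (HEART (b1a)).
[cite: GortzWedhorn2023, (27.1.1) and §(27.2) (p. 607)] -/
theorem exists_grpObj_isMonHom_quotIncl [GrpObj G] [I.IsHopfIdeal R] :
    ∃ GZ : GrpObj (specOver R (Alg G ⧸ I)), letI := GZ; IsMonHom (quotIncl G I) := by
  let Z : SchemeOver R := specOver R (Alg G ⧸ I)
  let j : Z ⟶ G := quotIncl G I
  haveI : Mono j := mono_quotIncl G I
  haveI hZa : IsAffine Z.left := inferInstanceAs (IsAffine (Spec (CommRingCat.of (Alg G ⧸ I))))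
  haveI : IsAffineHom Z.hom := isAffineHom_of_isAffine Z.hom
  haveI : IsAffine (Z ⊗ Z).left := inferInstanceAs (IsAffine (pullback Z.hom Z.hom))
  haveI : IsAffine (𝟙_ (SchemeOver R)).left := inferInstanceAs (IsAffine (Spec (CommRingCat.of R)))
  -- multiplication: the point `(pr₁ ≫ j) · (pr₂ ≫ j)` of `G` over `Z ×_R Z` kills `I`
  have hm : I ≤ RingHom.ker (ptEquiv G (Alg (Z ⊗ Z)) ((isoSpecOver (Z ⊗ Z)).inv ≫ ((fst Z Z ≫ j) * (snd Z Z ≫ j)))).toRingHom := by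
    rw [MonObj.comp_mul, ← Category.assoc, ← Category.assoc]
    exact le_ker_ptEquiv_mul G I (le_ker_ptEquiv_comp_quotIncl G I _) (le_ker_ptEquiv_comp_quotIncl G I _)
  obtain ⟨mU, hmU⟩ := exists_comp_quotIncl_eq_of_affine G I _ hm
  -- unit: the unit point over `Spec R = 𝟙_` kills `I`
  have he : I ≤ RingHom.ker (ptEquiv G (Alg (𝟙_ (SchemeOver R))) ((isoSpecOver (𝟙_ (SchemeOver R))).inv ≫ (1 : 𝟙_ _ ⟶ G))).toRingHom := by
    rw [MonObj.comp_one]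
    exact le_ker_ptEquiv_one G I
  obtain ⟨eU, heU⟩ := exists_comp_quotIncl_eq_of_affine G I _ he
  -- inversion: the point `j⁻¹` of `G` over `Z` kills `I`
  have hi : I ≤ RingHom.ker (ptEquiv G (Alg Z) ((isoSpecOver Z).inv ≫ j⁻¹)).toRingHom := by
    rw [GrpObj.comp_inv]
    refine le_ker_ptEquiv_inv G I ?_
    have := le_ker_ptEquiv_isoSpecOver_inv_comp G I (𝟙 Z)
    rwa [Category.id_comp] at this
  obtain ⟨iU, hiU⟩ := exists_comp_quotIncl_eq_of_affine G I _ hi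
  -- assemble
  obtain ⟨GZ, -, -, -, hhom⟩ := exists_grpObj_isMonHom_of_lifts j mU
    (by rw [hmU, Hom.mul_def, lift_fst_comp_snd_comp]) eU
    (by rw [heU, Hom.one_def, toUnit_unique (toUnit (𝟙_ (SchemeOver R))) (𝟙 _), Category.id_comp]) iU
    (by rw [hiU, Hom.inv_def])
  exact ⟨GZ, hhom⟩

end Lifts

end AffineGroupScheme

end Literature.AlgebraicGeometry.GroupSchemes

end
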